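import Summits.Ventures.LatticeQCDFlow.Exactness.FlowSamplerMixtureHarmonicMean
import Summits.Ventures.LatticeQCDFlow.Exactness.ReversibleMixtureHarmonicMean
import HarnessLib

/-!
# MIX, DON'T ALTERNATE — `N` flows: the flow sampler with the mixture proposal `Σ αᵢ q̃ᵢ` never has larger `τ_int` than randomly alternating the `N` flow samplers, for every square-integrable observable

HONEST FRAMING: exact (Metropolis-corrected) sampling algorithms for lattice gauge theory;
figures of merit are autocorrelation/cost numbers at stated couplings and volumes; no
continuum-physics claim.  (SCALAR calibration rung S0-A: not a gauge result.)

Venture `LatticeQCDFlow` (cell pub-lqcd), topic `Exactness`; FANOUT row 2 (`s0-phi4`, FLOW arm).  NEW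
WORK of the cell: the `N`-component form of gen-22's `FlowSamplerMixtureProposal.mixture_tauInt_le_alt`
(Tierney 1998 Prop. 5 / Liu 2001 Thm 13.3.4 NAMED; finite-state version in the tree as
`Literature…MixtureProposalPeskun`).  Two ways to use `N` trained flows `q̃ᵢ` with weights `αᵢ`:
(MIX) ONE independence sampler proposing from `q̄ = Σ αᵢ q̃ᵢ`; (ALT) at each step pick flow `i` with
probability `αᵢ` and do that flow's exact step — the kernel mixture `M = Σ αᵢ K_{q̃ᵢ}`.  Since
`𝓔_q̄ ≥ Σ αᵢ 𝓔_{q̃ᵢ} = 𝓔_M` on all of `L²(w)` (`finMixture_dirichlet_ge`, `RevOp.dirichlet_mixN_eq`) and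
`K_q̄` is positive, the tree's variational calculus gives: ALT-series summable ⇒ MIX-series summable
and **`τ_int^{MIX}(g) ≤ τ_int^{ALT}(g)`** (one-sided summability).  Together with the harmonic-mean files:
`τ^{MIX} + ½ ≤ τ^{ALT} + ½ ≤ 1/Σ αᵢ/(τ^{q̃ᵢ} + ½)`.  Nothing is cited as a fact.

## What is proved

* `altN_revOp` — (ALT) is in the `RevOp` format on the square-integrable class (stab/lin/symm/contr);
* **`finMixture_tauInt_le_altN`** — the comparison.

NOT CLAIMED: cost (MIX evaluates all `N` densities per proposal, ALT one); strictness; any value.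
-/

namespace Summit.Ventures.LatticeQCDFlow.Exactness

open Real MeasureTheory Filter Finset Set Topology
open Summit.Ventures.LatticeQCDFlow.Scoring

section General

variable {X : Type*} [MeasurableSpace X] {μ : Measure X} [SFinite μ] {w : X → ℝ}
  {ι : Type*} [Fintype ι] {q : ι → X → ℝ} {α : ι → ℝ} {M : (X → ℝ) → (X → ℝ)}

/-- (ALT) `M f = Σ αᵢ K_{q̃ᵢ} f` satisfies the `RevOp` hypotheses on the square-integrable class. -/
theorem altN_revOp (hα : ∀ i, 0 < α i) (hα1 : ∑ i, α i = 1) (hw0 : ∀ x, 0 < w x)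
    (hwm : Measurable w) (hwi : Integrable w μ) (hq0 : ∀ i x, 0 < q i x)
    (hqm : ∀ i, Measurable (q i)) (hqi : ∀ i, Integrable (q i) μ) (hq1 : ∀ i, ∫ z, q i z ∂μ = 1)
    (hM : ∀ f x, M f x = ∑ i, α i * imhOp μ w (q i) f x) :
    (∀ ⦃f : X → ℝ⦄, (Measurable f ∧ Integrable (fun t => f t ^ 2 * w t) μ) →
      (Measurable (M f) ∧ Integrable (fun t => M f t ^ 2 * w t) μ)) ∧
    (∀ ⦃f h : X → ℝ⦄ (c : ℝ), (Measurable f ∧ Integrable (fun t => f t ^ 2 * w t) μ) →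
      (Measurable h ∧ Integrable (fun t => h t ^ 2 * w t) μ) →
      ∀ x, M (fun s => f s + c * h s) x = M f x + c * M h x) ∧
    (∀ ⦃f h : X → ℝ⦄, (Measurable f ∧ Integrable (fun t => f t ^ 2 * w t) μ) →
      (Measurable h ∧ Integrable (fun t => h t ^ 2 * w t) μ) →
      ∫ x, M f x * h x * w x ∂μ = ∫ x, f x * M h x * w x ∂μ) ∧
    (∀ ⦃f : X → ℝ⦄, (Measurable f ∧ Integrable (fun t => f t ^ 2 * w t) μ) →
      ∫ x, M f x ^ 2 * w x ∂μ ≤ ∫ x, f x ^ 2 * w x ∂μ) := by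
  refine ⟨fun f hf => ?_, fun f h c hf hh x => ?_, fun f h hf hh => ?_, fun f hf => ?_⟩
  · exact RevOp.mixN_mem (A := fun f : X → ℝ => Measurable f ∧ Integrable (fun t => f t ^ 2 * w t) μ)
      (K := fun i => imhOp μ w (q i)) (sqClass_comb hw0 hwm)
      (fun i => sqClass_stab hw0 hwm hwi (hq0 i) (hqm i) (hqi i) (hq1 i)) hM hf
  · exact RevOp.mixN_add_mul (A := fun f : X → ℝ => Measurable f ∧ Integrable (fun t => f t ^ 2 * w t) μ)
      (K := fun i => imhOp μ w (q i)) (fun i => sqClass_lin hw0 hwm hwi (hq0 i) (hqm i) (hqi i)) hM c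
      hf hh x
  · exact RevOp.mixN_symm (A := fun f : X → ℝ => Measurable f ∧ Integrable (fun t => f t ^ 2 * w t) μ)
      (K := fun i => imhOp μ w (q i)) (sqClass_int hw0 hwm)
      (fun i => sqClass_stab hw0 hwm hwi (hq0 i) (hqm i) (hqi i) (hq1 i))
      (fun i => sqClass_symm hw0 hwm hwi (hq0 i) (hqm i) (hqi i) (hq1 i)) hM hf hh
  · exact RevOp.mixN_contr (A := fun f : X → ℝ => Measurable f ∧ Integrable (fun t => f t ^ 2 * w t) μ)
      (K := fun i => imhOp μ w (q i)) (fun x => (hw0 x).le) (sqClass_int hw0 hwm) (sqClass_comb hw0 hwm)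
      (fun i => sqClass_stab hw0 hwm hwi (hq0 i) (hqm i) (hqi i) (hq1 i))
      (fun i => sqClass_contr hw0 hwm hwi (hq0 i) (hqm i) (hqi i) (hq1 i)) hM (fun i => (hα i).le) hα1 hf

/-- **MIX, DON'T ALTERNATE (`N` flows).**  `αᵢ > 0`, `Σ αᵢ = 1`, `q̃ᵢ > 0` normalised, `M f = Σ αᵢ K_{q̃ᵢ} f`;
`g` square-integrable with `∫ g² w > 0` and the normalised series under the ALTERNATION `M` summable.
Then under the MIXTURE sampler `imhOp μ w (Σ αᵢ q̃ᵢ)` the series is summable and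
`τ_int^{MIX}(g) ≤ τ_int^{ALT}(g)`. -/
theorem finMixture_tauInt_le_altN [Nonempty ι] (hα : ∀ i, 0 < α i) (hα1 : ∑ i, α i = 1)
    (hw0 : ∀ x, 0 < w x) (hwm : Measurable w) (hwi : Integrable w μ) (hq0 : ∀ i x, 0 < q i x)
    (hqm : ∀ i, Measurable (q i)) (hqi : ∀ i, Integrable (q i) μ) (hq1 : ∀ i, ∫ z, q i z ∂μ = 1)
    (hM : ∀ f x, M f x = ∑ i, α i * imhOp μ w (q i) f x) {g : X → ℝ} (hgm : Measurable g)
    (hg2 : Integrable (fun x => g x ^ 2 * w x) μ) (hP : 0 < ∫ x, g x ^ 2 * w x ∂μ)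
    (hsM : Summable fun n => (∫ x, g x * (M^[n + 1] g) x * w x ∂μ) / ∫ x, g x ^ 2 * w x ∂μ) :
    (Summable fun n => (∫ x, g x * ((imhOp μ w (fun z => ∑ i, α i * q i z))^[n + 1] g) x * w x ∂μ)
        / ∫ x, g x ^ 2 * w x ∂μ) ∧
    tauInt (fun n => (∫ x, g x * ((imhOp μ w (fun z => ∑ i, α i * q i z))^[n] g) x * w x ∂μ)
        / ∫ x, g x ^ 2 * w x ∂μ)
      ≤ tauInt (fun n => (∫ x, g x * (M^[n] g) x * w x ∂μ) / ∫ x, g x ^ 2 * w x ∂μ) := by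
  obtain ⟨hs0, hsm, hsi, hs1⟩ := finMixture_facts hα hα1 hq0 hqm hqi hq1
  obtain ⟨hMS, hML, hMY, hMC⟩ := altN_revOp hα hα1 hw0 hwm hwi hq0 hqm hqi hq1 hM
  set P := ∫ x, g x ^ 2 * w x ∂μ with hPdef
  set CM : ℕ → ℝ := fun k => ∫ x, g x * (M^[k] g) x * w x ∂μ with hCM
  set T := ∑' k, CM k / P with hT
  have hposs := (acceptanceCeiling_setup_of_sq hw0 hwm hwi hs0 hsm hsi hs1 hgm hg2).2
  -- the sharp variational inequality for (ALT), then domination `𝓔_ALT ≤ 𝓔_MIX`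
  have hvar : ∀ ⦃v : X → ℝ⦄, (Measurable v ∧ Integrable (fun t => v t ^ 2 * w t) μ) →
      (∫ x, g x * v x * w x ∂μ) ^ 2
        ≤ P * T * ((∫ x, v x ^ 2 * w x ∂μ)
          - ∫ x, v x * imhOp μ w (fun z => ∑ i, α i * q i z) v x * w x ∂μ) := by
    intro v hv
    have h2 := RevOp.sq_inner_le_tsum_mul_dirichlet (A := fun f : X → ℝ =>
        Measurable f ∧ Integrable (fun t => f t ^ 2 * w t) μ) (K := M) (fun x => (hw0 x).le)
      (sqClass_int hw0 hwm) (sqClass_comb hw0 hwm) hMS hML hMY hMC ⟨hgm, hg2⟩ hv hsM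
    have hdom : (∫ x, v x ^ 2 * w x ∂μ) - ∫ x, v x * M v x * w x ∂μ
        ≤ (∫ x, v x ^ 2 * w x ∂μ) - ∫ x, v x * imhOp μ w (fun z => ∑ i, α i * q i z) v x * w x ∂μ := by
      rw [RevOp.dirichlet_mixN_eq (A := fun f : X → ℝ => Measurable f ∧ Integrable (fun t => f t ^ 2 * w t) μ)
        (K := fun i => imhOp μ w (q i)) (sqClass_int hw0 hwm)
        (fun i => sqClass_stab hw0 hwm hwi (hq0 i) (hqm i) (hqi i) (hq1 i)) hM hα1 hv]
      exact finMixture_dirichlet_ge hα hα1 hw0 hwm hwi hq0 hqm hqi hq1 hv.1 hv.2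
    -- `T ≥ 0` (indeed the bound at `v = g` forces it); handle the sign of `T`
    by_cases hT0 : 0 ≤ T
    · calc (∫ x, g x * v x * w x ∂μ) ^ 2 ≤ P * (T * ((∫ x, v x ^ 2 * w x ∂μ)
            - ∫ x, v x * M v x * w x ∂μ)) := h2
        _ ≤ P * (T * ((∫ x, v x ^ 2 * w x ∂μ)
            - ∫ x, v x * imhOp μ w (fun z => ∑ i, α i * q i z) v x * w x ∂μ)) :=
            mul_le_mul_of_nonneg_left (mul_le_mul_of_nonneg_left hdom hT0) hP.le
        _ = _ := by ring
    · -- `T < 0` contradicts the bound at `v = g`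
      exfalso
      have hg' := RevOp.sq_inner_le_tsum_mul_dirichlet (A := fun f : X → ℝ =>
          Measurable f ∧ Integrable (fun t => f t ^ 2 * w t) μ) (K := M) (fun x => (hw0 x).le)
        (sqClass_int hw0 hwm) (sqClass_comb hw0 hwm) hMS hML hMY hMC ⟨hgm, hg2⟩ ⟨hgm, hg2⟩ hsM
      have hgg : ∫ x, g x * g x * w x ∂μ = P := integral_congr_ae (Eventually.of_forall fun x => by
        show g x * g x * w x = g x ^ 2 * w x; ring)
      have hX : (∑' k, (∫ x, g x * (M^[k] g) x * w x ∂μ) / ∫ x, g x ^ 2 * w x ∂μ) = T := rfl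
      rw [hgg, hX, ← hPdef] at hg'
      have hE0 : 0 ≤ P - ∫ x, g x * M g x * w x ∂μ := by
        have := RevOp.quadForm_nonneg (A := fun f : X → ℝ =>
          Measurable f ∧ Integrable (fun t => f t ^ 2 * w t) μ) (fun x => (hw0 x).le)
          (sqClass_int hw0 hwm) hMS hMC ⟨hgm, hg2⟩ zero_le_one le_rfl
        rw [one_mul] at this
        exact this
      have hneg : P * (T * (P - ∫ x, g x * M g x * w x ∂μ)) ≤ 0 :=
        mul_nonpos_of_nonneg_of_nonpos hP.le (mul_nonpos_of_nonpos_of_nonneg (le_of_not_ge hT0) hE0)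
      nlinarith [hg', hneg, hP]
  have hT0 : 0 ≤ T := by
    by_contra h
    have hg' := hvar ⟨hgm, hg2⟩
    have hE0 : 0 ≤ (∫ x, g x ^ 2 * w x ∂μ)
        - ∫ x, g x * imhOp μ w (fun z => ∑ i, α i * q i z) g x * w x ∂μ := by
      have := RevOp.quadForm_nonneg (A := fun f : X → ℝ =>
        Measurable f ∧ Integrable (fun t => f t ^ 2 * w t) μ) (fun x => (hw0 x).le)
        (sqClass_int hw0 hwm) (sqClass_stab hw0 hwm hwi hs0 hsm hsi hs1)
        (sqClass_contr hw0 hwm hwi hs0 hsm hsi hs1) ⟨hgm, hg2⟩ zero_le_one le_rfl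
      rw [one_mul] at this
      exact this
    have hgg : ∫ x, g x * g x * w x ∂μ = P := integral_congr_ae (Eventually.of_forall fun x => by
      show g x * g x * w x = g x ^ 2 * w x; ring)
    rw [hgg] at hg'
    have hneg : P * T * ((∫ x, g x ^ 2 * w x ∂μ)
        - ∫ x, g x * imhOp μ w (fun z => ∑ i, α i * q i z) g x * w x ∂μ) ≤ 0 :=
      mul_nonpos_of_nonpos_of_nonneg (mul_nonpos_of_nonneg_of_nonpos hP.le (le_of_not_ge h)) hE0
    nlinarith [hg', hneg, hP]
  obtain ⟨hsum, hτ⟩ := RevOp.tauInt_le_of_forall_sq_inner_le_dirichlet_of_nonneg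
    (A := fun f : X → ℝ => Measurable f ∧ Integrable (fun x => f x ^ 2 * w x) μ)
    (K := imhOp μ w (fun z => ∑ i, α i * q i z)) (sqClass_int hw0 hwm) (sqClass_comb hw0 hwm)
    (sqClass_stab hw0 hwm hwi hs0 hsm hsi hs1) (sqClass_lin hw0 hwm hwi hs0 hsm hsi)
    (sqClass_symm hw0 hwm hwi hs0 hsm hsi hs1) ⟨hgm, hg2⟩ hP hposs (mul_nonneg hP.le hT0) hvar
  refine ⟨hsum, hτ.trans (le_of_eq ?_)⟩
  have hsρM : Summable fun k => CM k / P := (summable_nat_add_iff 1).1 hsM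
  have hCM0 : CM 0 / P = 1 := by
    have e : CM 0 = P := by
      simp only [hCM, hPdef, Function.iterate_zero, id_eq]
      exact integral_congr_ae (Eventually.of_forall fun x => by ring)
    rw [e, div_self hP.ne']
  have hTeq : T = 1 + ∑' k, CM (k + 1) / P := by rw [hT, hsρM.tsum_eq_zero_add, hCM0]
  show P * T / P - 1 / 2 = tauInt (fun n => CM n / P)
  rw [mul_div_cancel_left₀ T hP.ne', hTeq]
  unfold tauInt
  ring

end General

end Summit.Ventures.LatticeQCDFlow.Exactness
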